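import Summits.Ventures.CertifiedManyBodySolver.Transport.ChainWindowSpinFlip
import HarnessLib

/-!
# Ventures/CertifiedManyBodySolver — Transport/ChainWindowSpinRotation.lean

Speedrun cell sr-mbsolver / programme hubbard-alg — LIT team (lit-1 gen-13), LEAD ruling r156 (g1) object **LD1′**
(pub-hubbard liaison HOME/INBOX l.4904 (3): "the one missing edge S8(b) `jw-srot`").
HONEST FRAMING: first certified bounds; not a superconductivity verdict; every number certified or labelled float.

WHAT THIS GIVES. FORMAT-ltisdp's model form `jw-srot` (`hubbard_jwsrot_U<U>`, §4.11; SOUNDNESS-ltisdp S8 (b)) is the Hubbard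
chain with SPIN-FLIPPED hopping, `H' = −t Σ_{i,σ} (c†_{iσ} c_{i+1,σ̄} + h.c.) + U Σ_i n_{i↑} n_{i↓}`, i.e. the image of the standard
form under the product `V = Π_{j odd} u_j` of the one-site spin flips `u` (`uSpinFlip`, `Transport/ChainWindowSpinFlip.lean`) on
the ODD sites; only `N = N↑ + N↓` is a one-site-invariant charge of `H'`. The L3 lever's D6 rung (MPS-compressed LTI / KSDN lower
bounds for the chain) runs on `N`-only-charged `jw-srot` tensors, so its certificates prove the window statement for the `jw-srot`
rows: for every window variable `ρ' : Op (PolySite {-1, …, n+1}) 4` that is PSD with trace one, locally translation invariant,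
block diagonal in the TOTAL occupation `Σ_x |occ(k_x)|`, with total density of site `-1` equal to `ν`, real entries bounded by one —
`E ≤ Re tr(toSpin(U n_{-1↑}n_{-1↓} − t Σ_σ (c†_{-1σ} c_{0σ̄} + c†_{0σ̄} c_{-1σ})) ρ')`.

`ksdnClaim_of_srotClaim` (sibling file `Transport/ChainWindowSpinRotationRows.lean`; this file = the algebra: the staggered family,
its signed-permutation bookkeeping, the bond observables) proves that this statement IMPLIES the standard-form window statement — the `hclaim` of
`lti_primal_chainWindow_energyDensity[At]_ge_ksdn` (`Transport/LTIPrimalHubbardChainKSDN.lean`; by name `Rows.LTIChainKSDNNode`):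
`(N↑, N↓)` sectors and the bond objective `U n_{-1↑}n_{-1↓} − t Σ_σ (c†_{-1σ} c_{0σ} + c†_{0σ} c_{-1σ})`. WINDOW-LEVEL proof, no
even-ring clause: given `ρ` feasible for the standard rows, (1) replace it by the spin-flip midpoint `ρ₁ = ½(ρ + FρF)`,
`F = ⨂_x u` (every row is midpoint-convex and `F`-symmetric, the objective is `F`-invariant: `ChainWindowMidpoint.lean`,
`ChainWindowSpinFlip.lean`), so that `F ρ₁ F = ρ₁`; (2) conjugate: `ρ₂ = V ρ₁ Vᴴ`, `V = ⨂_x v_x`, `v_x = u` on odd `x`, `1` on even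
`x`. Then `ρ₂` is PSD, trace one, real, bounded, `N`-sectored (`V` is a signed permutation of configurations preserving `N`), its
site-`-1` total density is that of `ρ₁` (`v (n↑ + n↓) vᴴ = n↑ + n↓`), and it IS locally translation invariant: the partial traces
over the last / first site carry `V` to `⨂_x v_{x+1}` resp. `⨂_x v_x` on the `(n+2)`-site window, and `v_{x+1} = v_x · u` sitewise,
so the two differ exactly by the spin flip of the small window, under which the common marginal of the `F`-invariant `ρ₁` is
invariant (`spinPartialTrace_productOp_conj`). Finally `V · toSpin(h_bond) · Vᴴ = toSpin(h'_bond)` on the bond `(-1, 0)` (site `-1`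
odd, site `0` even: `u (c†_σ F) u = c†_{σ̄} F`, `u (F c_σ) u = F c_{σ̄}`, `u n↑n↓ u = n↑n↓`), so the `jw-srot` bound at `ρ₂` is the
standard bound at `ρ₁`, which is the standard bound at `ρ`.

Nothing is asserted: every statement is a theorem about arbitrary matrices; the only definition is the explicit one-site family
`oddSiteSpinFlip`. No `sorry`, no new axiom, no named fact.
[cite: KullEtAl2024, §II.B eq. (locTIn), §IV.B, §VI.B] [cite: EsslerEtAl2005, §12.3.4 eqs. (12.196)–(12.201)]
-/

noncomputable section

open Matrix Complex
open scoped ComplexOrder BigOperators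
open Literature.Probability.LatticeModels
open Literature.MathematicalPhysics.QuantumLattice
open Literature.MathematicalPhysics.QuantumLattice.HubbardWave0
open Literature.MathematicalPhysics.QuantumLattice.JordanWigner

namespace Summit.Ventures.CertifiedManyBodySolver.Transport

/-! ### §1 One site: total occupation, the swap, `u (n↑ + n↓) u = n↑ + n↓` -/

section OneSite

/-- `|occ(a)| = [↑ ∈ occ(a)] + [↓ ∈ occ(a)]`. [folklore] -/
theorem card_siteOcc_eq (a : Fin 4) : (siteOcc a).card =
    (if (0 : Fin 2) ∈ siteOcc a then 1 else 0) + (if (1 : Fin 2) ∈ siteOcc a then 1 else 0) := by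
  fin_cases a <;> simp [siteOcc]

/-- The swap `↑ ↔ ↓` preserves the total occupation of a site. [folklore] -/
theorem card_siteOcc_swap (a : Fin 4) : (siteOcc ((![0, 2, 1, 3] : Fin 4 → Fin 4) a)).card = (siteOcc a).card := by
  fin_cases a <;> simp [siteOcc]

/-- `u (n↑ + n↓) uᴴ = n↑ + n↓`. [cite: EsslerEtAl2005, §12.3.4 eq. (12.196)] -/
theorem uSpinFlip_conj_siteTotalNumber :
    uSpinFlip * (siteNumber 0 + siteNumber 1) * uSpinFlipᴴ = siteNumber 0 + siteNumber 1 := by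
  rw [Matrix.mul_add, Matrix.add_mul, uSpinFlip_conj_siteNumber, uSpinFlip_conj_siteNumber, add_comm]
  rfl

end OneSite

/-! ### §2 The staggered family `v_x` (`u` on odd sites, `1` on even sites) and `V = ⨂_x v_x` -/

section Staggered

variable {Λ : Finset (Site 1)}

/-- **The staggered one-site family of SOUNDNESS-ltisdp S8 (b)**: the spin flip `u` on the ODD sites, the identity on the even
sites (`V = Π_{j odd}` swap of the two spin modes of site `j`). [cite: EsslerEtAl2005, §12.3.4 eqs. (12.196)–(12.201)] -/
def oddSiteSpinFlip (y : PolySite Λ) : Matrix (Fin 4) (Fin 4) ℂ := if Odd (ofLex y.1 0) then uSpinFlip else 1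

/-- `v_x = u` on an odd site. [folklore] -/
theorem oddSiteSpinFlip_of_odd {y : PolySite Λ} (h : Odd (ofLex y.1 0)) : oddSiteSpinFlip y = uSpinFlip := if_pos h

/-- `v_x = 1` on an even site. [folklore] -/
theorem oddSiteSpinFlip_of_not_odd {y : PolySite Λ} (h : ¬ Odd (ofLex y.1 0)) : oddSiteSpinFlip y = 1 := if_neg h

/-- `v_xᴴ = v_x`. [folklore] -/
theorem oddSiteSpinFlip_conjTranspose (y : PolySite Λ) : (oddSiteSpinFlip y)ᴴ = oddSiteSpinFlip y := by
  by_cases h : Odd (ofLex y.1 0)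
  · rw [oddSiteSpinFlip_of_odd h, uSpinFlip_conjTranspose]
  · rw [oddSiteSpinFlip_of_not_odd h, Matrix.conjTranspose_one]

/-- `v_x² = 1`. [folklore] -/
theorem oddSiteSpinFlip_mul_self (y : PolySite Λ) : oddSiteSpinFlip y * oddSiteSpinFlip y = 1 := by
  by_cases h : Odd (ofLex y.1 0)
  · rw [oddSiteSpinFlip_of_odd h, uSpinFlip_mul_self]
  · rw [oddSiteSpinFlip_of_not_odd h, Matrix.mul_one]

/-- `v_x v_xᴴ = 1`. [folklore] -/
theorem oddSiteSpinFlip_mul_conjTranspose (y : PolySite Λ) : oddSiteSpinFlip y * (oddSiteSpinFlip y)ᴴ = 1 := by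
  rw [oddSiteSpinFlip_conjTranspose, oddSiteSpinFlip_mul_self]

/-- `v_xᴴ v_x = 1`. [folklore] -/
theorem oddSiteSpinFlip_conjTranspose_mul (y : PolySite Λ) : (oddSiteSpinFlip y)ᴴ * oddSiteSpinFlip y = 1 := by
  rw [oddSiteSpinFlip_conjTranspose, oddSiteSpinFlip_mul_self]

/-- `v_x` is unitary. [folklore] -/
theorem oddSiteSpinFlip_mem_unitaryGroup (y : PolySite Λ) : oddSiteSpinFlip y ∈ Matrix.unitaryGroup (Fin 4) ℂ := by
  rw [Matrix.mem_unitaryGroup_iff, Matrix.star_eq_conjTranspose, oddSiteSpinFlip_mul_conjTranspose]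

/-- `v_x (n↑ + n↓) v_xᴴ = n↑ + n↓` on every site. [cite: EsslerEtAl2005, §12.3.4 eq. (12.196)] -/
theorem oddSiteSpinFlip_conj_siteTotalNumber (y : PolySite Λ) :
    oddSiteSpinFlip y * (siteNumber 0 + siteNumber 1) * (oddSiteSpinFlip y)ᴴ = siteNumber 0 + siteNumber 1 := by
  by_cases h : Odd (ofLex y.1 0)
  · rw [oddSiteSpinFlip_of_odd h, uSpinFlip_conj_siteTotalNumber]
  · rw [oddSiteSpinFlip_of_not_odd h, Matrix.conjTranspose_one, Matrix.one_mul, Matrix.mul_one]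

/-- `v_x` is a signed permutation: `v_x a b = [b = p_x a] · t_x a` with `p_x` the swap on odd `x` (identity on even `x`) and
`t_x = (1,1,1,−1)` on odd `x` (`1` on even `x`). [folklore] -/
theorem oddSiteSpinFlip_apply (y : PolySite Λ) (a b : Fin 4) :
    oddSiteSpinFlip y a b =
      if b = (if Odd (ofLex y.1 0) then (![0, 2, 1, 3] : Fin 4 → Fin 4) a else a) then
        (if Odd (ofLex y.1 0) then (![1, 1, 1, -1] : Fin 4 → ℂ) a else 1) else 0 := by
  by_cases h : Odd (ofLex y.1 0)
  · rw [oddSiteSpinFlip_of_odd h, if_pos h, if_pos h, uSpinFlip_apply]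
  · rw [oddSiteSpinFlip_of_not_odd h, if_neg h, if_neg h, Matrix.one_apply]
    by_cases hab : a = b
    · rw [if_pos hab, if_pos hab.symm]
    · rw [if_neg hab, if_neg (Ne.symm hab)]

/-- `Vᴴ = V` for `V = ⨂_x v_x`. [folklore] -/
theorem spinRot_conjTranspose : (productOp (oddSiteSpinFlip (Λ := Λ)))ᴴ = productOp oddSiteSpinFlip := by
  rw [productOp_conjTranspose]
  exact congrArg productOp (funext fun y => oddSiteSpinFlip_conjTranspose y)

/-- `Vᴴ V = 1`. [folklore] -/
theorem spinRot_conjTranspose_mul_self : (productOp (oddSiteSpinFlip (Λ := Λ)))ᴴ * productOp oddSiteSpinFlip = 1 :=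
  productOp_conjTranspose_mul oddSiteSpinFlip_conjTranspose_mul

/-- `V Vᴴ = 1`. [folklore] -/
theorem spinRot_mul_conjTranspose : productOp (oddSiteSpinFlip (Λ := Λ)) * (productOp oddSiteSpinFlip)ᴴ = 1 :=
  productOp_mul_conjTranspose oddSiteSpinFlip_mul_conjTranspose

/-- `V` is a signed permutation of configurations: `V k l = [l = p ∘ k] · ∏_x t_x(k_x)`. [folklore] -/
theorem spinRot_apply (k l : TensorIndex (PolySite Λ) 4) :
    productOp (oddSiteSpinFlip (Λ := Λ)) k l =
      if l = (fun y : PolySite Λ => if Odd (ofLex y.1 0) then (![0, 2, 1, 3] : Fin 4 → Fin 4) (k y) else k y) then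
        ∏ y : PolySite Λ, (if Odd (ofLex y.1 0) then (![1, 1, 1, -1] : Fin 4 → ℂ) (k y) else 1) else 0 :=
  productOp_apply_of_signedPerm (u := oddSiteSpinFlip)
    (fun (y : PolySite Λ) a => if Odd (ofLex y.1 0) then (![0, 2, 1, 3] : Fin 4 → Fin 4) a else a)
    (fun (y : PolySite Λ) a => if Odd (ofLex y.1 0) then (![1, 1, 1, -1] : Fin 4 → ℂ) a else 1)
    (fun y a b => oddSiteSpinFlip_apply y a b) k l

/-- The configuration map of `V` preserves the total occupation `N = Σ_x |occ(k_x)|`. [folklore] -/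
theorem totCount_spinRot (k : TensorIndex (PolySite Λ) 4) :
    (∑ y : PolySite Λ, (siteOcc (if Odd (ofLex y.1 0) then (![0, 2, 1, 3] : Fin 4 → Fin 4) (k y) else k y)).card) =
      ∑ y, (siteOcc (k y)).card := by
  refine Finset.sum_congr rfl fun y _ => ?_
  by_cases h : Odd (ofLex y.1 0)
  · rw [if_pos h, card_siteOcc_swap]
  · rw [if_neg h]

/-- **`N`-sector zeros survive `V`.** [folklore] -/
theorem spinRot_sectorRow {ρ : Op (PolySite Λ) 4}
    (hρ : ∀ k k' : TensorIndex (PolySite Λ) 4, (∑ y, (siteOcc (k y)).card) ≠ (∑ y, (siteOcc (k' y)).card) → ρ k k' = 0)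
    (k k' : TensorIndex (PolySite Λ) 4) (hk : (∑ y, (siteOcc (k y)).card) ≠ (∑ y, (siteOcc (k' y)).card)) :
    (productOp (oddSiteSpinFlip (Λ := Λ)) * ρ * (productOp oddSiteSpinFlip)ᴴ : Op (PolySite Λ) 4) k k' = 0 := by
  refine sectorRow_signedPerm_conj _ _ spinRot_apply (ι := Unit)
    (fun _ (l : TensorIndex (PolySite Λ) 4) => ∑ y, (siteOcc (l y)).card) ?_ (fun _ l l' hl => hρ l l' hl) () k k' hk
  intro _ l l' hl
  refine ⟨(), ?_⟩
  rw [totCount_spinRot, totCount_spinRot]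
  exact hl

/-- **Real entries survive `V`** (its signs are `±1`). [folklore] -/
theorem spinRot_realRow {ρ : Op (PolySite Λ) 4} (hρ : ∀ k k', starRingEnd ℂ (ρ k k') = ρ k k')
    (k k' : TensorIndex (PolySite Λ) 4) :
    starRingEnd ℂ ((productOp (oddSiteSpinFlip (Λ := Λ)) * ρ * (productOp oddSiteSpinFlip)ᴴ : Op (PolySite Λ) 4) k k') =
      (productOp (oddSiteSpinFlip (Λ := Λ)) * ρ * (productOp oddSiteSpinFlip)ᴴ : Op (PolySite Λ) 4) k k' := by
  refine realRow_signedPerm_conj _ _ spinRot_apply (fun l => ?_) hρ k k'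
  rw [star_prod]
  refine Finset.prod_congr rfl fun y _ => ?_
  by_cases h : Odd (ofLex y.1 0)
  · rw [if_pos h]
    generalize l y = a
    fin_cases a <;> simp
  · rw [if_neg h, star_one]

/-- **`(N↑, N↓)`-sector zeros are `N`-sector zeros**: configurations with different total occupation differ in `N↑` or in `N↓`.
[folklore] -/
theorem totSectorRow_of_sectorRow {Y : Type} [Fintype Y] {ρ : Op Y 4}
    (hρ : ∀ σ : Fin 2, ∀ k k' : TensorIndex Y 4,
      (∑ x, if σ ∈ siteOcc (k x) then 1 else 0 : ℕ) ≠ (∑ x, if σ ∈ siteOcc (k' x) then 1 else 0 : ℕ) → ρ k k' = 0)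
    (k k' : TensorIndex Y 4) (hk : (∑ x, (siteOcc (k x)).card) ≠ (∑ x, (siteOcc (k' x)).card)) : ρ k k' = 0 := by
  by_contra hne
  apply hk
  have h : ∀ σ : Fin 2, (∑ x, if σ ∈ siteOcc (k x) then 1 else 0 : ℕ) = (∑ x, if σ ∈ siteOcc (k' x) then 1 else 0 : ℕ) :=
    fun σ => by
      by_contra hσ
      exact hne (hρ σ k k' hσ)
  simp only [card_siteOcc_eq, Finset.sum_add_distrib, h 0, h 1]

/-- `V (onSite x a) Vᴴ = onSite x (v_x a v_xᴴ)`. [folklore] -/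
theorem spinRot_conj_onSite (x : PolySite Λ) (a : Matrix (Fin 4) (Fin 4) ℂ) :
    productOp oddSiteSpinFlip * onSite x a * (productOp oddSiteSpinFlip)ᴴ =
      onSite x (oddSiteSpinFlip x * a * (oddSiteSpinFlip x)ᴴ) :=
  productOp_conj_onSite oddSiteSpinFlip_mul_conjTranspose x a

/-- `V (onSite x a · onSite y b) Vᴴ = onSite x (v_x a v_xᴴ) · onSite y (v_y b v_yᴴ)`. [folklore] -/
theorem spinRot_conj_onSite_mul_onSite (x y : PolySite Λ) (a b : Matrix (Fin 4) (Fin 4) ℂ) :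
    productOp oddSiteSpinFlip * (onSite x a * onSite y b) * (productOp oddSiteSpinFlip)ᴴ =
      onSite x (oddSiteSpinFlip x * a * (oddSiteSpinFlip x)ᴴ) * onSite y (oddSiteSpinFlip y * b * (oddSiteSpinFlip y)ᴴ) := by
  rw [productOp_conj_mul oddSiteSpinFlip_conjTranspose_mul, spinRot_conj_onSite, spinRot_conj_onSite]

end Staggered

/-! ### §3 Traces under conjugation -/

section Conj

variable {Y : Type} [Fintype Y] [DecidableEq Y] {q : ℕ}

/-- `tr(H' · UρUᴴ) = tr(H ρ)` when `Uᴴ H' U = H`. [folklore] -/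
theorem trace_mul_conj_of_conj {U H H' : Op Y q} (hH : Uᴴ * H' * U = H) (ρ : Op Y q) :
    (H' * (U * ρ * Uᴴ)).trace = (H * ρ).trace := by
  rw [show H' * (U * ρ * Uᴴ) = (H' * U * ρ) * Uᴴ by simp only [Matrix.mul_assoc], Matrix.trace_mul_cycle,
    show Uᴴ * (H' * U) * ρ = (Uᴴ * H' * U) * ρ by simp only [Matrix.mul_assoc], hH]

/-- From `U A Uᴴ = B` and `Uᴴ U = 1`: `Uᴴ B U = A`. [folklore] -/
theorem conjTranspose_conj_eq_of_conj_eq {U A B : Op Y q} (hU : Uᴴ * U = 1) (h : U * A * Uᴴ = B) : Uᴴ * B * U = A := by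
  rw [← h]
  calc Uᴴ * (U * A * Uᴴ) * U = (Uᴴ * U) * A * (Uᴴ * U) := by simp only [Matrix.mul_assoc]
    _ = A := by rw [hU, Matrix.one_mul, Matrix.mul_one]

end Conj

/-! ### §4 The bond observables of the standard and of the `jw-srot` form in the product basis -/

section Bond

variable {Λ : Finset (Site 1)}

/-- The total density `n_{x↑} + n_{x↓} ↦ onSite x (n↑ + n↓)`. [cite: EsslerEtAl2005, §12.3.4 eq. (12.196)] -/
theorem toSpin_siteTotal (x : Site 1) (hx : x ∈ Λ) :
    toSpin (nAt x hx 0 + nAt x hx 1) = onSite (PolySite.pt x hx) (siteNumber 0 + siteNumber 1) := by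
  rw [map_add, nAt, nAt, toSpin_numberOp, toSpin_numberOp, onSite_add']

/-- **The KSDN bond observable with a spin map `τ` on the second site, in the product basis** (`y = x + 1`):
`toSpin(U n_{x↑}n_{x↓} − t Σ_σ (c†_{xσ} c_{y,τσ} + c†_{y,τσ} c_{xσ})) = U (n↑n↓)_x − t Σ_σ [(c†_σ F)_x (c_{τσ})_y + (F c_σ)_x (c†_{τσ})_y]`.
(`τ = id`: FORMAT-ltisdp's `hubbard_jw` bond; `τ = σ ↦ σ̄`: its `jw-srot` bond.) [cite: EsslerEtAl2005, §12.3.4 eqs. (12.196)–(12.201)] -/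
theorem toSpin_ksdnBond (t U : ℝ) {x y : Site 1} (hx : x ∈ Λ) (hy : y ∈ Λ) (h : y 0 = x 0 + 1) (τ : Fin 2 → Fin 2) :
    toSpin ((U : ℂ) • (nAt x hx 0 * nAt x hx 1) +
        (-(t : ℂ)) • ∑ σ : Fin 2, ((cAt x hx σ)ᴴ * cAt y hy (τ σ) + (cAt y hy (τ σ))ᴴ * cAt x hx σ)) =
      (U : ℂ) • onSite (PolySite.pt x hx) siteDouble +
        (-(t : ℂ)) • ∑ σ : Fin 2,
          (onSite (PolySite.pt x hx) (siteCreation σ * siteParity) * onSite (PolySite.pt y hy) (siteAnnihilation (τ σ)) +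
            onSite (PolySite.pt x hx) (siteParity * siteAnnihilation σ) * onSite (PolySite.pt y hy) (siteCreation (τ σ))) := by
  obtain ⟨hlt, hcov⟩ := pt_covBy_of_succ hx hy h
  rw [map_add, map_smul, map_smul, map_sum, nAt, nAt, toSpin_numberOp_mul_numberOp]
  congr 2
  refine Finset.sum_congr rfl fun σ _ => ?_
  rw [map_add, cAt, cAt, annihilation_conjTranspose, annihilation_conjTranspose,
    toSpin_creation_mul_annihilation_of_covBy hlt hcov, toSpin_creation_mul_annihilation_of_covBy' hlt hcov]

/-- The standard bond (`τ = id`). [cite: EsslerEtAl2005, §12.3.4 eqs. (12.196)–(12.201)] -/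
theorem toSpin_ksdnBond_jw (t U : ℝ) {x y : Site 1} (hx : x ∈ Λ) (hy : y ∈ Λ) (h : y 0 = x 0 + 1) :
    toSpin ((U : ℂ) • (nAt x hx 0 * nAt x hx 1) +
        (-(t : ℂ)) • ∑ σ : Fin 2, ((cAt x hx σ)ᴴ * cAt y hy σ + (cAt y hy σ)ᴴ * cAt x hx σ)) =
      (U : ℂ) • onSite (PolySite.pt x hx) siteDouble +
        (-(t : ℂ)) • ∑ σ : Fin 2,
          (onSite (PolySite.pt x hx) (siteCreation σ * siteParity) * onSite (PolySite.pt y hy) (siteAnnihilation σ) +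
            onSite (PolySite.pt x hx) (siteParity * siteAnnihilation σ) * onSite (PolySite.pt y hy) (siteCreation σ)) :=
  toSpin_ksdnBond t U hx hy h fun σ => σ

/-- The `jw-srot` bond (`τ = σ ↦ σ̄`). [cite: EsslerEtAl2005, §12.3.4 eqs. (12.196)–(12.201)] -/
theorem toSpin_ksdnBond_srot (t U : ℝ) {x y : Site 1} (hx : x ∈ Λ) (hy : y ∈ Λ) (h : y 0 = x 0 + 1) :
    toSpin ((U : ℂ) • (nAt x hx 0 * nAt x hx 1) +
        (-(t : ℂ)) • ∑ σ : Fin 2, ((cAt x hx σ)ᴴ * cAt y hy σ.rev + (cAt y hy σ.rev)ᴴ * cAt x hx σ)) =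
      (U : ℂ) • onSite (PolySite.pt x hx) siteDouble +
        (-(t : ℂ)) • ∑ σ : Fin 2,
          (onSite (PolySite.pt x hx) (siteCreation σ * siteParity) * onSite (PolySite.pt y hy) (siteAnnihilation σ.rev) +
            onSite (PolySite.pt x hx) (siteParity * siteAnnihilation σ) * onSite (PolySite.pt y hy) (siteCreation σ.rev)) :=
  toSpin_ksdnBond t U hx hy h Fin.rev

/-- **The standard bond observable is spin-flip invariant**: `F · toSpin(h_bond) · Fᴴ = toSpin(h_bond)`, `F = ⨂_x u`.
[cite: EsslerEtAl2005, §12.3.4 eqs. (12.196)–(12.201)] -/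
theorem spinFlip_conj_toSpin_ksdnBond (t U : ℝ) {x y : Site 1} (hx : x ∈ Λ) (hy : y ∈ Λ) (h : y 0 = x 0 + 1) :
    productOp (fun _ : PolySite Λ => uSpinFlip) * toSpin ((U : ℂ) • (nAt x hx 0 * nAt x hx 1) +
        (-(t : ℂ)) • ∑ σ : Fin 2, ((cAt x hx σ)ᴴ * cAt y hy σ + (cAt y hy σ)ᴴ * cAt x hx σ)) *
        (productOp (fun _ : PolySite Λ => uSpinFlip))ᴴ =
      toSpin ((U : ℂ) • (nAt x hx 0 * nAt x hx 1) +
        (-(t : ℂ)) • ∑ σ : Fin 2, ((cAt x hx σ)ᴴ * cAt y hy σ + (cAt y hy σ)ᴴ * cAt x hx σ)) := by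
  rw [toSpin_ksdnBond_jw t U hx hy h, conj_add, conj_smul, conj_smul, conj_sum, spinFlip_conj_onSite,
    uSpinFlip_conj_siteDouble]
  congr 2
  rw [← sum_fin_two_rev]
  refine Finset.sum_congr rfl fun σ _ => ?_
  rw [conj_add, spinFlip_conj_onSite_mul_onSite, spinFlip_conj_onSite_mul_onSite, uSpinFlip_conj_siteCreation_mul_siteParity,
    uSpinFlip_conj_siteAnnihilation, uSpinFlip_conj_siteParity_mul_siteAnnihilation, uSpinFlip_conj_siteCreation, Fin.rev_rev]

/-- **`V` carries the standard bond to the `jw-srot` bond** when the LEFT site `x` is odd (so `y = x + 1` is even):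
`V · toSpin(h_bond) · Vᴴ = toSpin(h'_bond)`. [cite: EsslerEtAl2005, §12.3.4 eqs. (12.196)–(12.201)] -/
theorem spinRot_conj_toSpin_ksdnBond (t U : ℝ) {x y : Site 1} (hx : x ∈ Λ) (hy : y ∈ Λ) (h : y 0 = x 0 + 1)
    (hodd : Odd (x 0)) :
    productOp oddSiteSpinFlip * toSpin ((U : ℂ) • (nAt x hx 0 * nAt x hx 1) +
        (-(t : ℂ)) • ∑ σ : Fin 2, ((cAt x hx σ)ᴴ * cAt y hy σ + (cAt y hy σ)ᴴ * cAt x hx σ)) *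
        (productOp oddSiteSpinFlip)ᴴ =
      toSpin ((U : ℂ) • (nAt x hx 0 * nAt x hx 1) +
        (-(t : ℂ)) • ∑ σ : Fin 2, ((cAt x hx σ)ᴴ * cAt y hy σ.rev + (cAt y hy σ.rev)ᴴ * cAt x hx σ)) := by
  have hvx : oddSiteSpinFlip (PolySite.pt x hx) = uSpinFlip :=
    oddSiteSpinFlip_of_odd (by rw [PolySite.ofLex_coe_pt]; exact hodd)
  have hvy : oddSiteSpinFlip (PolySite.pt y hy) = 1 :=
    oddSiteSpinFlip_of_not_odd (by rw [PolySite.ofLex_coe_pt, h, Int.not_odd_iff_even]; exact hodd.add_one)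
  rw [toSpin_ksdnBond_jw t U hx hy h, toSpin_ksdnBond_srot t U hx hy h, conj_add, conj_smul, conj_smul, conj_sum,
    spinRot_conj_onSite, hvx, uSpinFlip_conj_siteDouble]
  congr 2
  rw [← sum_fin_two_rev]
  refine Finset.sum_congr rfl fun σ _ => ?_
  rw [conj_add, spinRot_conj_onSite_mul_onSite, spinRot_conj_onSite_mul_onSite, hvx, hvy,
    uSpinFlip_conj_siteCreation_mul_siteParity, uSpinFlip_conj_siteParity_mul_siteAnnihilation, Fin.rev_rev]
  simp only [Matrix.conjTranspose_one, Matrix.one_mul, Matrix.mul_one]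

/-- `F · toSpin(n_{x↑} + n_{x↓}) · Fᴴ = toSpin(n_{x↑} + n_{x↓})`. [cite: EsslerEtAl2005, §12.3.4 eq. (12.196)] -/
theorem spinFlip_conj_toSpin_siteTotal (x : Site 1) (hx : x ∈ Λ) :
    productOp (fun _ : PolySite Λ => uSpinFlip) * toSpin (nAt x hx 0 + nAt x hx 1) *
        (productOp (fun _ : PolySite Λ => uSpinFlip))ᴴ = toSpin (nAt x hx 0 + nAt x hx 1) := by
  rw [toSpin_siteTotal, spinFlip_conj_onSite, uSpinFlip_conj_siteTotalNumber]

/-- `V · toSpin(n_{x↑} + n_{x↓}) · Vᴴ = toSpin(n_{x↑} + n_{x↓})`. [cite: EsslerEtAl2005, §12.3.4 eq. (12.196)] -/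
theorem spinRot_conj_toSpin_siteTotal (x : Site 1) (hx : x ∈ Λ) :
    productOp oddSiteSpinFlip * toSpin (nAt x hx 0 + nAt x hx 1) * (productOp oddSiteSpinFlip)ᴴ =
      toSpin (nAt x hx 0 + nAt x hx 1) := by
  rw [toSpin_siteTotal, spinRot_conj_onSite, oddSiteSpinFlip_conj_siteTotalNumber]

end Bond

end Summit.Ventures.CertifiedManyBodySolver.Transport
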